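import Literature.MathematicalPhysics.QuantumFieldTheory.Balaban1983to89.B8Thm4TorusAt
import Literature.MathematicalPhysics.QuantumFieldTheory.Balaban1983to89.B8LeafModelZd3NonVacuity
import Literature.MathematicalPhysics.QuantumFieldTheory.Balaban1983to89.B8CubeMemberZd
import HarnessLib

/-!
# Route «BalabanUVNodes» (K3 `SpineGivenEndpointR11`), DAG node N16 = NE3 — THE LETTER JUNCTION from node N05's leaf currency to N16's
# `ℤᵈ` reading of [B8] THEOREM 4: the Theorem-4 clause of `B8.Thm4Body c₁ B₁′` AT THE ALL-TORUS MEMBER of n05-a's family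
# `B8LeafModelZd3.zdGF3` ⟹ `B8Thm4TorusAt.Thm4TorusAt L k 0 η c₁′ (unitaryUnits 𝔸) Reg (Restr129 L k (torusLam k)) Concl_T4`

Cell `pub-ymgap`, seat `pub-ymgap-dag-n16-c` (R134 fan-out seat, strategy s1; HUMAN RULING D-0062; chair R424 venue), generation 0, file 3;
`--supports stmt-QuantumFields-19676`; `bears_on: R4∕N16 · edge N05 → N16`.

WHY.  File 2 (`…N16Thm4TorusOfZd`) reduced N16's N05-side hypothesis to the `ℤᵈ` reading of Theorem 4 at the all-torus member — the
interface `Thm4TorusAt` at PERIOD `0` (data on `ℤᵈ`, a gauge on `ℤᵈ`, uniqueness among ALL unitary gauges).  Node N05's currency for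
Theorem 4 is the abstract leaf `B8.Thm4Body c₁ B₁′ fam` on n05-a's concrete family `fam i = (zdGF3 𝔸 L β len i).toGFData`
(`B8LeafModelZd3.thm4Printed_zd3`, modulo its sockets), whose index `ZdIdx d L` CONTAINS the all-torus member
(`B8LeafModelZd3NonVacuity.exists_member_univ`: `Ω_j = ℤᵈ` for all `j`, constraint sites `Λs m j = {j = m}` = `torusLam m`, constraint bonds
likewise).  THIS FILE is the letter-for-letter junction between the two: at that member the leaf's fields `InA ∕ InAAx ∕ avgClose166 ∕
Restricted ∕ act ∕ C137 ∕ Landau ∕ C162` ARE the interface's `InAk … univ`, `InAk ∧ InAx … (torusLam ·)` (all truncations, §1),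
`Cond166T` (§1: `(U′U₀)‾ʲ − Ū₀ʲ = (Ũ′ʲ − 1)·Ū₀ʲ` with `Ū₀ʲ` unitary), `Restr129 … (torusLam k)`, `U′ ↦ U′^{u⁻¹}`, and — the canonical
masked logarithm `mlogCfg` being the plain logarithm `logCfg` when every bond is a side of a plaquette touching `ℤᵈ` (`d ≥ 2`) — the
three conclusions (1.37), (1.38), (1.62) read on `A := (iη)⁻¹ log U′^{u⁻¹}`.  Uniqueness transfers because a competitor's Lie-algebra
field `A′` with `U′ = (e^{iηA′})^{u′}` and `‖A′‖ ≤ B₁′(α₀+α₁)(Lᵏη)⁻¹ ≤ (16η)⁻¹` IS `(iη)⁻¹ log` of its gauge-fixed field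
(`B8Prop3GaugeFixedKLevel.logField_spec`), so the leaf's uniqueness clause applies to it.

WHAT THIS FILE PROVES (kernel, theorems only, 0 `def`, 0 sorry):
§1 geometry ∕ algebra of the all-torus member: `sideTouches_univ` (`d ≥ 2`), `mlogCfg_univ` (masked log = log), `inAx_torusLam_of_le`
   (`Ax_k` w.r.t. `torusLam k` ⟹ `Ax_m` w.r.t. `torusLam m`, `m ≤ k`: every site lies under a top-level site, `B8CubeMemberZd.inAx_of_cover`),
   `pdev_lt_of_inAk_univ` + `avgIter_mem_unitaryUnits_of_inAk_univ` (`U₀ ∈ 𝔄_k({ℤᵈ}, α₀)` ⟹ all averages `Ū₀ʲ`, `j ≤ k`, unitary, Prop. 2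
   of [Balaban1985Averaging] in the window `C₀·2α₀ ≤ ⅓`, `4α₀ ≤ c₂′`), `norm_avgIter_mul_sub_le` ∕ `avgClose_of_cond166T` ∕ `sides_of_cond166T`
   ((1.66) in `tavg` letters ⟹ the leaf's box form (1.66)₁ and its level-0 side form).
§2 **`thm4TorusAt_zero_of_leaf_member`**: for `d, L ≥ 2`, a member `i` of `ZdIdx d L` with `Ω_j = univ`, `Λs m j = {j = m}`, `Λb m j = {j = m}`,
   constants `c₁′ ≤ c₁`, `0 ≤ B₁′`, `16·B₁′·c₁′ ≤ 1`, `C₀·2c₁′ ≤ ⅓`, `4c₁′ ≤ c₂′`: the Theorem-4 clause of the leaf at `i` (constants `c₁, B₁′`)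
   ⟹ `Thm4TorusAt L i.k 0 i.η c₁′ (unitaryUnits 𝔸) Reg (Restr129 L i.k (torusLam i.k)) Concl_T4` for EVERY `Reg`, where
   `Concl_T4 α₀ α₁ U₀ U′ u := ∃ A` self-adjoint, `mgauge U₀ u (cfgExp η A) = U′`, (1.62) `‖A‖ ≤ B₁′(α₀+α₁)(Lᵏη)⁻¹`, (1.38)
   `IsLandau138 L k η univ (torusLam k) U₀ A`, (1.37) `‖logCovIter L U₀ (iEta η A) k c‖ < 2dLα₁` at every level-`k` bond `c`.
§3 **`thm4TorusAt_zero_of_thm4Body_univ`** ∕ **`thm4TorusAt_zero_of_thm4Body`**: the same from `B8.Thm4Body c₁ B₁′` on the univ sub-family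
   `{i : ZdIdx d L // i.Ω 0 = univ}` (the index shape of NODE 00's family of record `Node00/CarriersB8.IdxB8`) resp. on all of `ZdIdx d L`, at
   EVERY `k ≥ 1` and EVERY `η > 0`.
HONEST FRAMING: bookkeeping by name (a dictionary between two typed readings of the same printed theorem); Theorem 4 at curved backgrounds
= node N05's theorem (`B8.Thm4Body` on `zdGF3` is PROVED in the tree only modulo n05-a's sockets `SockP5base ∕ SockP5 ∕ SockH59 ∕ SockP5u`),
NOT proved here; N16 ∕ NE3 NOT discharged; count-neutral; finite lattice statements — NOT ℝ⁴, NOT infinite volume, NOT OS, NOT a mass gap,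
NOT Clay.
-/

set_option autoImplicit false

open scoped BigOperators
open NormedSpace

namespace Summit.QuantumFields.YangMills.BalabanUVNodes.N16.Thm4ZdOfLeaf

open Literature.MathematicalPhysics.QuantumFieldTheory.Balaban1983to89
open B7Prop1Explicit B7Prop2Explicit
open B7Eq92Concrete (mgauge)
open B8Ineq132 (InAk BondTouches PlaqTouches plaqF Under)
open B8Eq184Proof (cfgExp)
open B8Eq119TwistedAxial (Restr129 InAx)
open B8Eq138LandauZd (IsLandau138 IsLandau138W logCfg)
open B8Eq140Level (SideTouches sideTouches_of_bondTouches)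
open B8Eq146AExpansion (iEta)
open B7Prop4GeneralLevels (logCovIter)
open B8Thm4TorusAt (torusLam torusLam_self mem_torusLam_iff Cond166T Thm4TorusAt)
open B8Prop6OfThm4 (tavg)
open B8Lemma1NonAbelian (mulCfg)
open B8LeafModelZd (ZdIdx)
open B8LeafModelZd3 (zdGF3 mlogCfg mlogCfg_of_sideTouches)
open B8LeafModelZd3NonVacuity (exists_member_univ)
open B8Eq131Cubes (flm under_flm)
open B8CubeMemberZd (inAx_of_cover)
open B8Prop3GaugeFixedKLevel (eq_mgauge_inv_of_mgauge_eq mem_unitaryUnits_of_mgauge_eq logField_spec)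
open B8Thm4AtLandau138 (mgauge_mgauge_inv)
open B12Ineq417Flat (shiftCfg shiftCfg_zero)

noncomputable section

variable {d : ℕ}

/-! ## §1 Geometry and algebra of the all-torus member -/

section Geometry

/-- For `d ≥ 2` every bond of `ℤᵈ` is a side of a plaquette touching `ℤᵈ`. [cite: Balaban1985RegularSpaces, p.77 (bond ∕ plaquette convention before (1.5))] -/
theorem sideTouches_univ (hd2 : 2 ≤ d) (y : Site d) (τ : Fin d) : SideTouches (Set.univ : Set (Site d)) y τ := by
  haveI : Nontrivial (Fin d) := Fin.nontrivial_iff_two_le.mpr hd2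
  obtain ⟨κ, hκ⟩ := exists_ne τ
  exact sideTouches_of_bondTouches hκ (Or.inl (Set.mem_univ _))

/-- The constraint-site family `j ↦ {y | j = m}` of `B8LeafModelZd3NonVacuity.exists_member_univ` IS `torusLam m`.
[cite: Balaban1985RegularSpaces, (1.5) p.77] -/
theorem setOf_eq_torusLam (m : ℕ) : (fun j : ℕ => {_y : Site d | j = m}) = torusLam m := by
  funext j
  ext y
  rw [Set.mem_setOf_eq, mem_torusLam_iff]

variable {𝔸 : Type*} [NormedRing 𝔸] [NormedAlgebra ℂ 𝔸] [CompleteSpace 𝔸]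

/-- **`Ax_k` FOR `torusLam k` GIVES `Ax_m` FOR `torusLam m`, `m ≤ k`** (the axial conditions (1.19) below a level-`m` site `x` are among those
below the level-`k` site `⌊x ∕ L^{k−m}⌋` over it; `L ≥ 1`). [cite: Balaban1985RegularSpaces, (1.19) p.79, (1.34) p.82] -/
theorem inAx_torusLam_of_le {L : ℕ} (hL : 1 ≤ L) {k m : ℕ} (hm : m ≤ k) {U₀ W : Site d → Fin d → 𝔸ˣ}
    (h : InAx L k (torusLam k) U₀ W) : InAx L m (torusLam m) U₀ W := by
  refine inAx_of_cover (fun j _ hjm xj _ => ⟨k, hjm.trans hm, le_rfl, flm L (k - j) xj, ?_, under_flm hL _ xj⟩) h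
  rw [torusLam_self]; exact Set.mem_univ _

end Geometry

section Averages

variable {𝔸 : Type} [CStarAlgebra 𝔸] [Nontrivial 𝔸]

omit [Nontrivial 𝔸] in
/-- **`U₀ ∈ 𝔄_k({ℤᵈ}, α₀)` BOUNDS THE PLAQUETTE DEVIATION**: `sup_p |U₀(∂p) − 1| < 2α₀·L^{−2k}` ((1.7) at `j = k` on `Ω_k = ℤᵈ` is
`|U₀(∂p) − 1| < α₀L^{−2k}` at EVERY plaquette; the supremum is `≤ α₀L^{−2k} < 2α₀L^{−2k}`). [cite: Balaban1985RegularSpaces, (1.7) p.77] -/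
theorem pdev_lt_of_inAk_univ {L : ℕ} (hL : 1 ≤ L) {k : ℕ} {η α₀ : ℝ} (hα₀ : 0 < α₀) {U : Site d → Fin d → 𝔸ˣ}
    (h : InAk L k η α₀ (fun _ => (Set.univ : Set (Site d))) U) : pdev U < 2 * α₀ * (((L : ℝ) ^ k)⁻¹) ^ 2 := by
  have hLk : (0 : ℝ) < ((L : ℝ) ^ k)⁻¹ := by
    have : (1 : ℝ) ≤ (L : ℝ) ^ k := one_le_pow₀ (by exact_mod_cast hL)
    positivity
  have hle : pdev U ≤ α₀ * (((L : ℝ) ^ k)⁻¹) ^ 2 := by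
    unfold pdev
    refine Real.iSup_le (fun p => ?_) (by positivity)
    rcases eq_or_ne p.2.1 p.2.2 with hp | hp
    · rw [hp, hol_plaqWord_self, Units.val_one, sub_self, norm_zero]; positivity
    · exact ((h k le_rfl).1 p.1 p.2.1 p.2.2 hp (Or.inl (Set.mem_univ _))).le
  have hpos : 0 < α₀ * (((L : ℝ) ^ k)⁻¹) ^ 2 := by positivity
  linarith

/-- **… SO ALL ITS AVERAGES `Ū₀ʲ`, `j ≤ k`, ARE UNITARY** for unitary-valued `U₀`, `L ≥ 2`, in the Proposition-2 window `C₀·2α₀ ≤ ⅓`,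
`4α₀ ≤ c₂′` (`B7Prop2Explicit.avgIter_mem` for the unitary group). [cite: Balaban1985Averaging, Prop. 2 (52)–(53) p.26; Balaban1985RegularSpaces, (1.33) p.82] -/
theorem avgIter_mem_unitaryUnits_of_inAk_univ {L : ℕ} (hL : 2 ≤ L) {k : ℕ} {η α₀ : ℝ} (hα₀ : 0 < α₀)
    (hα3 : C0 d * (2 * α₀) ≤ 1 / 3) (hα4 : 4 * α₀ ≤ c2' d L) {U₀ : Site d → Fin d → 𝔸ˣ}
    (hU₀ : ∀ x κ, U₀ x κ ∈ unitaryUnits 𝔸) (h : InAk L k η α₀ (fun _ => (Set.univ : Set (Site d))) U₀) :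
    ∀ j ≤ k, ∀ (x : Site d) (κ : Fin d), avgIter L U₀ j x κ ∈ unitaryUnits 𝔸 :=
  avgIter_mem L hL (avgClosed_unitaryUnits d L) k U₀ hU₀ (by positivity) hα3 (by linarith)
    (pdev_lt_of_inAk_univ (le_trans (by norm_num) hL) hα₀ h)

/-- **`(U′U₀)‾ʲ − Ū₀ʲ = (Ũ′ʲ − 1)·Ū₀ʲ`**, hence `‖(U′U₀)‾ʲ − Ū₀ʲ‖ ≤ ‖Ũ′ʲ − 1‖` at a bond where `Ū₀ʲ` is unitary (`Ũ′ʲ = (U′U₀)‾ʲ(Ū₀ʲ)⁻¹`,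
(1.20)). [cite: Balaban1985RegularSpaces, (1.20) p.79, (1.35) p.82, (1.66) p.87] -/
theorem norm_avgIter_mul_sub_le {L : ℕ} {U₀ U' : Site d → Fin d → 𝔸ˣ} {j : ℕ} {z : Site d} {μ : Fin d}
    (hu : avgIter L U₀ j z μ ∈ unitaryUnits 𝔸) :
    ‖(avgIter L (U' * U₀) j z μ : 𝔸) - (avgIter L U₀ j z μ : 𝔸)‖ ≤ ‖(tavg L U₀ U' j z μ : 𝔸) - 1‖ := by
  have h1 : (avgIter L (U' * U₀) j z μ : 𝔸) = (tavg L U₀ U' j z μ : 𝔸) * (avgIter L U₀ j z μ : 𝔸) := by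
    show _ = ((avgIter L (U' * U₀) j z μ * (avgIter L U₀ j z μ)⁻¹ : 𝔸ˣ) : 𝔸) * _
    rw [← Units.val_mul, inv_mul_cancel_right]
  calc ‖(avgIter L (U' * U₀) j z μ : 𝔸) - (avgIter L U₀ j z μ : 𝔸)‖
      = ‖((tavg L U₀ U' j z μ : 𝔸) - 1) * (avgIter L U₀ j z μ : 𝔸)‖ := by rw [sub_mul, one_mul, ← h1]
    _ ≤ ‖(tavg L U₀ U' j z μ : 𝔸) - 1‖ * ‖(avgIter L U₀ j z μ : 𝔸)‖ := norm_mul_le _ _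
    _ = ‖(tavg L U₀ U' j z μ : 𝔸) - 1‖ := by rw [CStarRing.norm_of_mem_unitary hu, mul_one]

/-- **(1.66) IN `tavg` LETTERS ⟹ THE LEAF's BOX FORM (1.66)₁** `‖(U′U₀)‾ʲ(z, μ) − Ū₀ʲ(z, μ)‖ ≤ α₁` at every level-`j` bond, `j ≤ k`, once the
averages `Ū₀ʲ` are unitary. [cite: Balaban1985RegularSpaces, (1.66) p.87, (1.35) p.82, (1.20) p.79] -/
theorem avgClose_of_cond166T {L k : ℕ} {U₀ U' : Site d → Fin d → 𝔸ˣ} {α₁ : ℝ} (h : Cond166T L k U₀ U' α₁)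
    (hu : ∀ j ≤ k, ∀ (x : Site d) (κ : Fin d), avgIter L U₀ j x κ ∈ unitaryUnits 𝔸) :
    ∀ j, j ≤ k → ∀ (z : Site d) (μ : Fin d), ‖(avgIter L (mulCfg U' U₀) j z μ : 𝔸) - (avgIter L U₀ j z μ : 𝔸)‖ ≤ α₁ :=
  fun j hj z μ => (norm_avgIter_mul_sub_le (hu j hj z μ)).trans (h j hj z μ).le

omit [Nontrivial 𝔸] in
/-- **(1.66) AT LEVEL 0 IS `|U′ − 1| < α₁` BONDWISE** (`Ũ′⁰ = (U′U₀)U₀⁻¹ = U′`). [cite: Balaban1985RegularSpaces, (1.66) p.87, (1.20) p.79] -/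
theorem sides_of_cond166T {L k : ℕ} {U₀ U' : Site d → Fin d → 𝔸ˣ} {α₁ : ℝ} (h : Cond166T L k U₀ U' α₁) (y : Site d) (τ : Fin d) :
    ‖((U' y τ : 𝔸ˣ) : 𝔸) - 1‖ ≤ α₁ := by
  have h0 := h 0 (Nat.zero_le _) y τ
  have e : tavg L U₀ U' 0 y τ = U' y τ := by
    show avgIter L (U' * U₀) 0 y τ * (avgIter L U₀ 0 y τ)⁻¹ = U' y τ
    rw [avgIter_zero, avgIter_zero, Pi.mul_apply, Pi.mul_apply, mul_inv_cancel_right]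
  rw [e] at h0
  exact h0.le

omit [Nontrivial 𝔸] in
/-- **ON THE ALL-TORUS MEMBER THE CANONICAL MASKED LOGARITHM IS THE LOGARITHM** (`d ≥ 2`: every bond is a side of a plaquette touching
`Ω₀ = ℤᵈ`). [cite: Balaban1985RegularSpaces, (1.36) p.82, p.89 («A₀ = (1/iη) log U′»)] -/
theorem mlogCfg_univ (hd2 : 2 ≤ d) (k : ℕ) (η : ℝ) {Ω : ℕ → Set (Site d)} (hΩ : ∀ j, Ω j = Set.univ)
    (W : Site d → Fin d → 𝔸ˣ) : mlogCfg k η Ω W = logCfg η W := by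
  funext y τ
  exact mlogCfg_of_sideTouches η W (Nat.zero_le k) (by rw [hΩ 0]; exact sideTouches_univ hd2 y τ)

end Averages

/-! ## §2 The junction at the all-torus member -/

section Member

variable {𝔸 : Type} [CStarAlgebra 𝔸] [Nontrivial 𝔸]

/-- **THE LETTER JUNCTION AT THE ALL-TORUS MEMBER.**  Let `d, L ≥ 2` and let `i : ZdIdx d L` be an all-torus member (`Ω_j = ℤᵈ` for all `j`,
`Λs m j = {j = m}`, `Λb m j = {j = m}`).  If the Theorem-4 clause of the abstract leaf `B8.Thm4Body` holds at the member `zdGF3 𝔸 L β len i`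
with constants `c₁, B₁′` — for `α₀, α₁ > 0`, `α₀ + α₁ ≤ c₁`, data `U₀`, `(U₀, U′)` with `InA ∕ Reg335 ∕ InAAx ∕ avgClose166` there is exactly
one `u : GT` with `Restricted` and (1.37) `C137`, (1.38) `Landau`, (1.62) `C162 B₁′ (α₀+α₁)` for `U′^{u⁻¹}` — then for every `Reg` and every
`c₁′ ≤ c₁` with `0 ≤ B₁′`, `16·B₁′·c₁′ ≤ 1`, `C₀·2c₁′ ≤ ⅓`, `4c₁′ ≤ c₂′`:
`Thm4TorusAt L i.k 0 i.η c₁′ (unitaryUnits 𝔸) Reg (Restr129 L i.k (torusLam i.k)) Concl_T4`, `Concl_T4 α₀ α₁ U₀ U′ u := ∃ A` self-adjoint with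
`U′ = (e^{iηA})^{u}` rel. `U₀`, `‖A‖ ≤ B₁′(α₀+α₁)(Lᵏη)⁻¹`, `IsLandau138 L k η univ (torusLam k) U₀ A`, `‖logCovIter L U₀ (iηA) k c‖ < 2dLα₁` at every
level-`k` bond (print's (1.62), (1.38), (1.37) for `U₁ = U′^{u⁻¹} = e^{iηA}`).  Existence: the leaf's `u` with `A := (iη)⁻¹ log U′^{u⁻¹}` (the
masked logarithm is the logarithm here, §1).  Uniqueness: a competitor's `A′` is `(iη)⁻¹ log` of ITS gauge-fixed field (`logField_spec`,
`η‖A′‖ ≤ B₁′c₁′ ≤ 1∕16`), so the leaf's uniqueness clause applies.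
[cite: Balaban1985RegularSpaces, Thm 4 p.88, (1.29) p.81, (1.33)–(1.34) p.82, (1.37)–(1.38) p.82, (1.62) p.87, (1.66) p.87, p.77 («Ω_j = T_η»)] -/
theorem thm4TorusAt_zero_of_leaf_member (hd2 : 2 ≤ d) {L : ℕ} (hL : 2 ≤ L) {β : ℝ} {len : Site d → ℝ} (i : ZdIdx d L)
    (hΩ : ∀ j, i.Ω j = Set.univ) (hΛs : ∀ m j, i.Λs m j = {_y | j = m}) (hΛb : ∀ m j, i.Λb m j = {_c | j = m})
    {c₁ c₁' B₁' : ℝ} (hc : c₁' ≤ c₁) (hB : 0 ≤ B₁') (h16 : 16 * (B₁' * c₁') ≤ 1) (hC0 : C0 d * (2 * c₁') ≤ 1 / 3)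
    (hc2 : 4 * c₁' ≤ c2' d L) (Reg : (Site d → Fin d → 𝔸ˣ) → Prop)
    (hT : ∀ α₀ α₁ : ℝ, 0 < α₀ → 0 < α₁ → α₀ + α₁ ≤ c₁ →
      ∀ (U₀ : (zdGF3 𝔸 L β len i).Cfg) (P : (zdGF3 𝔸 L β len i).Pert),
        (zdGF3 𝔸 L β len i).InA α₀ U₀ → (zdGF3 𝔸 L β len i).Reg335 α₀ U₀ → (zdGF3 𝔸 L β len i).InAAx α₀ U₀ P →
        (zdGF3 𝔸 L β len i).avgClose166 α₁ U₀ P →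
          ∃ u : (zdGF3 𝔸 L β len i).GT, (zdGF3 𝔸 L β len i).Restricted U₀ u ∧
            ((zdGF3 𝔸 L β len i).C137 α₁ U₀ ((zdGF3 𝔸 L β len i).act P u) ∧
              (zdGF3 𝔸 L β len i).Landau U₀ ((zdGF3 𝔸 L β len i).act P u) ∧
              (zdGF3 𝔸 L β len i).C162 B₁' (α₀ + α₁) U₀ ((zdGF3 𝔸 L β len i).act P u)) ∧
            ∀ u' : (zdGF3 𝔸 L β len i).GT, (zdGF3 𝔸 L β len i).Restricted U₀ u' →
              (zdGF3 𝔸 L β len i).C137 α₁ U₀ ((zdGF3 𝔸 L β len i).act P u') →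
              (zdGF3 𝔸 L β len i).Landau U₀ ((zdGF3 𝔸 L β len i).act P u') →
              (zdGF3 𝔸 L β len i).C162 B₁' (α₀ + α₁) U₀ ((zdGF3 𝔸 L β len i).act P u') → u' = u) :
    Thm4TorusAt L i.k 0 i.η c₁' (unitaryUnits 𝔸) Reg (Restr129 L i.k (torusLam i.k))
      (fun (α₀ α₁ : ℝ) (U₀ U' : Site d → Fin d → 𝔸ˣ) (u : Site d → 𝔸ˣ) =>
        ∃ A : Site d → Fin d → 𝔸,
          (∀ x μ, IsSelfAdjoint (A x μ)) ∧ mgauge U₀ u (cfgExp i.η A) = U' ∧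
          (∀ x μ, ‖A x μ‖ ≤ B₁' * (α₀ + α₁) * ((L : ℝ) ^ i.k * i.η)⁻¹) ∧
          IsLandau138 L i.k i.η Set.univ (torusLam i.k) U₀ A ∧
          (∀ (y : Site d) (ν : Fin d), ‖logCovIter L U₀ (iEta i.η A) i.k y ν‖ < 2 * d * L * α₁)) := by
  intro α₀ α₁ hα₀ hα₁ hs U₀ U' hU₀G hU'G _ _ hA₀ _ hA hAx h166
  have hL1 : 1 ≤ L := le_trans (by norm_num) hL
  have hL1r : (1 : ℝ) ≤ L := by exact_mod_cast hL1
  have hη := i.hη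
  -- the member's sets
  have hΩ' : i.Ω = fun _ => Set.univ := funext hΩ
  have hΛs' : ∀ m, i.Λs m = torusLam m := fun m => by
    rw [← setOf_eq_torusLam m]; funext j; exact hΛs m j
  have hmemΛb : ∀ (j : ℕ) (c : Site d × Fin d), c ∈ i.Λb i.k j ↔ j = i.k := fun j c => by
    rw [hΛb, Set.mem_setOf_eq]
  have hst : ∀ (j : ℕ) (y : Site d) (τ : Fin d), SideTouches (i.Ω j) y τ := fun j y τ => by
    rw [hΩ j]; exact sideTouches_univ hd2 y τ
  have hmlog : ∀ W : Site d → Fin d → 𝔸ˣ, mlogCfg i.k i.η i.Ω W = logCfg i.η W := mlogCfg_univ hd2 i.k i.η hΩ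
  -- letters: `B₁′(α₀+α₁)L^{-k} ≤ 1/16`, and the Prop.-2 window at `α₀`
  have hs0 : 0 ≤ α₀ + α₁ := by linarith
  have hBs : B₁' * (α₀ + α₁) ≤ 1 / 16 := by nlinarith [mul_le_mul_of_nonneg_left hs hB]
  have hLk : (1 : ℝ) ≤ (L : ℝ) ^ i.k := one_le_pow₀ hL1r
  have hLkη : 0 < (L : ℝ) ^ i.k * i.η := by positivity
  have hα0c : α₀ ≤ c₁' := by linarith
  have hC0' : C0 d * (2 * α₀) ≤ 1 / 3 :=
    (mul_le_mul_of_nonneg_left (by linarith) (C0_pos d).le).trans hC0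
  have hunit : ∀ j ≤ i.k, ∀ (x : Site d) (κ : Fin d), avgIter L U₀ j x κ ∈ unitaryUnits 𝔸 :=
    avgIter_mem_unitaryUnits_of_inAk_univ hL hα₀ hC0' (by linarith) hU₀G hA₀
  -- the leaf's data at the member
  let U₀c : (zdGF3 𝔸 L β len i).Cfg := ⟨U₀, hU₀G⟩
  let P : (zdGF3 𝔸 L β len i).Pert := (U₀c, ⟨U', hU'G⟩)
  have hInA : (zdGF3 𝔸 L β len i).InA α₀ U₀c := by
    show InAk L i.k i.η α₀ i.Ω U₀
    rw [hΩ']; exact hA₀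
  have hInAAx : (zdGF3 𝔸 L β len i).InAAx α₀ U₀c P := by
    refine ⟨rfl, ?_, fun m hm => ?_⟩
    · show InAk L i.k i.η α₀ i.Ω (mulCfg U' U₀)
      rw [hΩ']; exact hA
    · show InAx L m (i.Λs m) U₀ (mulCfg U' U₀)
      rw [hΛs' m]; exact inAx_torusLam_of_le hL1 hm hAx
  have h166' : (zdGF3 𝔸 L β len i).avgClose166 α₁ U₀c P := by
    refine ⟨fun j hj z μ _ => ?_, fun b _ => ?_⟩
    · show ‖(avgIter L (mulCfg U' U₀) j z μ : 𝔸) - (avgIter L U₀ j z μ : 𝔸)‖ ≤ α₁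
      exact avgClose_of_cond166T h166 hunit j hj z μ
    · show ‖((U' b.1 b.2 : 𝔸ˣ) : 𝔸) - 1‖ ≤ α₁
      exact sides_of_cond166T h166 b.1 b.2
  obtain ⟨u, h129, ⟨h137, hLan, h162⟩, huniq⟩ := hT α₀ α₁ hα₀ hα₁ (hs.trans hc) U₀c P hInA trivial hInAAx h166'
  -- the gauge-fixed field `W = U′^{u⁻¹}` and its logarithm
  have hW : mgauge U₀ u.1 (mgauge U₀ u.1⁻¹ U') = U' := mgauge_mgauge_inv U₀ U' u.1
  have h162' : ∀ (y : Site d) (τ : Fin d), mgauge U₀ u.1⁻¹ U' y τ = cfgExp i.η (logCfg i.η (mgauge U₀ u.1⁻¹ U')) y τ ∧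
      IsSelfAdjoint (logCfg i.η (mgauge U₀ u.1⁻¹ U') y τ) ∧
      ‖logCfg i.η (mgauge U₀ u.1⁻¹ U') y τ‖ ≤ B₁' * (α₀ + α₁) * ((L : ℝ) ^ i.k * i.η)⁻¹ :=
    fun y τ => h162 i.k le_rfl (y, τ) (hst i.k y τ)
  have hWexp : mgauge U₀ u.1⁻¹ U' = cfgExp i.η (logCfg i.η (mgauge U₀ u.1⁻¹ U')) := by
    funext y τ; exact (h162' y τ).1
  refine ⟨u.1, ⟨u.2.1, fun x j => by rw [zero_smul, add_zero], ?_, logCfg i.η (mgauge U₀ u.1⁻¹ U'),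
    fun y τ => (h162' y τ).2.1, by rw [← hWexp]; exact hW, fun y τ => (h162' y τ).2.2, ?_, fun y ν => ?_⟩, ?_⟩
  · -- (1.29)
    have h := h129
    change Restr129 L i.k (i.Λs i.k) U₀ u.1 at h
    rwa [hΛs'] at h
  · -- (1.38) (the sets are rewritten through a generalisation: `u`'s type mentions `i.Ω 0`)
    have key : ∀ (S : Set (Site d)) (Λ : ℕ → Set (Site d)), S = Set.univ → Λ = torusLam i.k →
        IsLandau138 L i.k i.η S Λ U₀ (logCfg i.η (mgauge U₀ u.1⁻¹ U')) →
        IsLandau138 L i.k i.η Set.univ (torusLam i.k) U₀ (logCfg i.η (mgauge U₀ u.1⁻¹ U')) := by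
      rintro S Λ rfl rfl h; exact h
    exact key _ _ (hΩ 0) (hΛs' i.k) hLan
  · -- (1.37) at the level-`k` bonds
    have h := h137 i.k le_rfl (y, ν) ((hmemΛb i.k (y, ν)).2 rfl)
    change ‖logCovIter L U₀ (iEta i.η (mlogCfg i.k i.η i.Ω (mgauge U₀ u.1⁻¹ U'))) i.k y ν‖ < 2 * d * L * α₁ at h
    rwa [hmlog] at h
  · -- uniqueness among ALL unitary gauges with (1.29) and `Concl_T4`
    rintro u' hu'G - hRes' ⟨A', hsa', hmg', hbd', hLan', h137'⟩
    let u'c : (zdGF3 𝔸 L β len i).GT := ⟨u', hu'G, fun x hx => absurd (by rw [hΩ 0]; exact Set.mem_univ x) hx⟩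
    -- the competitor's gauge-fixed field is `e^{iηA′}`, and `A′` is its logarithm
    have hW'eq : mgauge U₀ u'⁻¹ U' = cfgExp i.η A' := (eq_mgauge_inv_of_mgauge_eq hmg').symm
    have hW'u : ∀ x κ, cfgExp i.η A' x κ ∈ unitaryUnits 𝔸 := mem_unitaryUnits_of_mgauge_eq hU₀G hU'G hu'G hmg'
    have ht : B₁' * (α₀ + α₁) * ((L : ℝ) ^ i.k)⁻¹ ≤ 1 / 16 := by
      have h1 : B₁' * (α₀ + α₁) * ((L : ℝ) ^ i.k)⁻¹ ≤ B₁' * (α₀ + α₁) * 1 :=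
        mul_le_mul_of_nonneg_left (inv_le_one_of_one_le₀ hLk) (mul_nonneg hB hs0)
      linarith
    have hbdη : ∀ x κ, ‖A' x κ‖ ≤ B₁' * (α₀ + α₁) * ((L : ℝ) ^ i.k)⁻¹ * i.η⁻¹ := fun x κ => by
      have h := hbd' x κ
      rwa [mul_inv, ← mul_assoc] at h
    have hlog : logCfg i.η (mgauge U₀ u'⁻¹ U') = A' := by
      rw [hW'eq]
      funext x κ
      exact (logField_spec hη U₀ hW'u (rfl : cfgExp i.η A' x κ = cfgExp i.η A' x κ) (hbdη x κ) ht).1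
    have hR' : (zdGF3 𝔸 L β len i).Restricted U₀c u'c := by
      show Restr129 L i.k (i.Λs i.k) U₀ u'
      rw [hΛs']; exact hRes'
    have h137'' : (zdGF3 𝔸 L β len i).C137 α₁ U₀c ((zdGF3 𝔸 L β len i).act P u'c) := by
      show ∀ j, j ≤ i.k → ∀ c ∈ i.Λb i.k j,
        ‖logCovIter L U₀ (iEta i.η (mlogCfg i.k i.η i.Ω (mgauge U₀ u'⁻¹ U'))) j c.1 c.2‖ < 2 * d * L * α₁
      intro j _ c hc
      obtain rfl := (hmemΛb j c).1 hc
      rw [hmlog, hlog]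
      exact h137' c.1 c.2
    have hLan'' : (zdGF3 𝔸 L β len i).Landau U₀c ((zdGF3 𝔸 L β len i).act P u'c) := by
      show IsLandau138 L i.k i.η (i.Ω 0) (i.Λs i.k) U₀ (logCfg i.η (mgauge U₀ u'⁻¹ U'))
      rw [hlog, hΩ 0, hΛs']; exact hLan'
    have h162'' : (zdGF3 𝔸 L β len i).C162 B₁' (α₀ + α₁) U₀c ((zdGF3 𝔸 L β len i).act P u'c) := by
      show ∀ j, j ≤ i.k → ∀ b ∈ {b : Site d × Fin d | SideTouches (i.Ω j) b.1 b.2},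
        mgauge U₀ u'⁻¹ U' b.1 b.2 = cfgExp i.η (logCfg i.η (mgauge U₀ u'⁻¹ U')) b.1 b.2 ∧
          IsSelfAdjoint (logCfg i.η (mgauge U₀ u'⁻¹ U') b.1 b.2) ∧
          ‖logCfg i.η (mgauge U₀ u'⁻¹ U') b.1 b.2‖ ≤ B₁' * (α₀ + α₁) * ((L : ℝ) ^ j * i.η)⁻¹
      intro j hj b _
      rw [hlog, hW'eq]
      refine ⟨rfl, hsa' b.1 b.2, (hbd' b.1 b.2).trans ?_⟩
      have hLj : (L : ℝ) ^ j * i.η ≤ (L : ℝ) ^ i.k * i.η :=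
        mul_le_mul_of_nonneg_right (pow_le_pow_right₀ hL1r hj) hη.le
      have hLj0 : 0 < (L : ℝ) ^ j * i.η := by positivity
      exact mul_le_mul_of_nonneg_left (inv_anti₀ hLj0 hLj) (mul_nonneg hB hs0)
    have heq := huniq u'c hR' h137'' hLan'' h162''
    exact congrArg Subtype.val heq

end Member

/-! ## §3 From `B8.Thm4Body` on n05-a's family, at every `k ≥ 1` and every `η > 0` -/

section Family

variable {𝔸 : Type} [CStarAlgebra 𝔸] [Nontrivial 𝔸]

/-- **N16's `ℤᵈ` READING OF THEOREM 4 FROM THE LEAF ON THE UNIV SUB-FAMILY** (the index shape `{i // i.Ω 0 = univ}` of NODE 00's family of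
record `Node00/CarriersB8.famB8OfRecord`): for `d, L ≥ 2`, `B8.Thm4Body c₁ B₁′ (fun i ↦ (zdGF3 𝔸 L β len i.1).toGFData)` and letters
`c₁′ ≤ c₁`, `0 ≤ B₁′`, `16·B₁′·c₁′ ≤ 1`, `C₀·2c₁′ ≤ ⅓`, `4c₁′ ≤ c₂′` give, at EVERY `k ≥ 1`, `η > 0` and for every `Reg`,
`Thm4TorusAt L k 0 η c₁′ (unitaryUnits 𝔸) Reg (Restr129 L k (torusLam k)) Concl_T4` (§2 at the member of `exists_member_univ`).
[cite: Balaban1985RegularSpaces, Thm 4 p.88, p.77 («we admit the case where some domains Ω_j are equal to T_η»)] -/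
theorem thm4TorusAt_zero_of_thm4Body_univ (hd2 : 2 ≤ d) {L : ℕ} (hL : 2 ≤ L) {β : ℝ} {len : Site d → ℝ} {c₁ c₁' B₁' : ℝ}
    (hc : c₁' ≤ c₁) (hB : 0 ≤ B₁') (h16 : 16 * (B₁' * c₁') ≤ 1) (hC0 : C0 d * (2 * c₁') ≤ 1 / 3) (hc2 : 4 * c₁' ≤ c2' d L)
    (hT : B8.Thm4Body c₁ B₁' (fun i : {i : ZdIdx d L // i.Ω 0 = Set.univ} => (zdGF3 𝔸 L β len i.1).toGFData))
    {k : ℕ} (hk : 1 ≤ k) {η : ℝ} (hη : 0 < η) (Reg : (Site d → Fin d → 𝔸ˣ) → Prop) :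
    Thm4TorusAt L k 0 η c₁' (unitaryUnits 𝔸) Reg (Restr129 L k (torusLam k))
      (fun (α₀ α₁ : ℝ) (U₀ U' : Site d → Fin d → 𝔸ˣ) (u : Site d → 𝔸ˣ) =>
        ∃ A : Site d → Fin d → 𝔸,
          (∀ x μ, IsSelfAdjoint (A x μ)) ∧ mgauge U₀ u (cfgExp η A) = U' ∧
          (∀ x μ, ‖A x μ‖ ≤ B₁' * (α₀ + α₁) * ((L : ℝ) ^ k * η)⁻¹) ∧
          IsLandau138 L k η Set.univ (torusLam k) U₀ A ∧
          (∀ (y : Site d) (ν : Fin d), ‖logCovIter L U₀ (iEta η A) k y ν‖ < 2 * d * L * α₁)) := by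
  obtain ⟨i, hΩ0, hik, hiη, hΩ, hΛs, hΛb⟩ := exists_member_univ (d := d) (le_trans (by norm_num) hL) hk hη
  subst hik hiη
  exact thm4TorusAt_zero_of_leaf_member hd2 hL i hΩ hΛs hΛb hc hB h16 hC0 hc2 Reg (hT ⟨i, hΩ0⟩)

/-- **… AND FROM THE LEAF ON ALL OF `ZdIdx d L`** (the index of n05-a's `B8LeafModelZd3.thm4Printed_zd3`): restriction to the univ sub-family.
[cite: Balaban1985RegularSpaces, Thm 4 p.88, p.77] -/
theorem thm4TorusAt_zero_of_thm4Body (hd2 : 2 ≤ d) {L : ℕ} (hL : 2 ≤ L) {β : ℝ} {len : Site d → ℝ} {c₁ c₁' B₁' : ℝ}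
    (hc : c₁' ≤ c₁) (hB : 0 ≤ B₁') (h16 : 16 * (B₁' * c₁') ≤ 1) (hC0 : C0 d * (2 * c₁') ≤ 1 / 3) (hc2 : 4 * c₁' ≤ c2' d L)
    (hT : B8.Thm4Body c₁ B₁' (fun i : ZdIdx d L => (zdGF3 𝔸 L β len i).toGFData))
    {k : ℕ} (hk : 1 ≤ k) {η : ℝ} (hη : 0 < η) (Reg : (Site d → Fin d → 𝔸ˣ) → Prop) :
    Thm4TorusAt L k 0 η c₁' (unitaryUnits 𝔸) Reg (Restr129 L k (torusLam k))
      (fun (α₀ α₁ : ℝ) (U₀ U' : Site d → Fin d → 𝔸ˣ) (u : Site d → 𝔸ˣ) =>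
        ∃ A : Site d → Fin d → 𝔸,
          (∀ x μ, IsSelfAdjoint (A x μ)) ∧ mgauge U₀ u (cfgExp η A) = U' ∧
          (∀ x μ, ‖A x μ‖ ≤ B₁' * (α₀ + α₁) * ((L : ℝ) ^ k * η)⁻¹) ∧
          IsLandau138 L k η Set.univ (torusLam k) U₀ A ∧
          (∀ (y : Site d) (ν : Fin d), ‖logCovIter L U₀ (iEta η A) k y ν‖ < 2 * d * L * α₁)) :=
  thm4TorusAt_zero_of_thm4Body_univ hd2 hL hc hB h16 hC0 hc2 (fun j => hT j.1) hk hη Reg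

/-- **THE WINDOW IS NOT EMPTY**: for `c₁ > 0`, `B₁′ ≥ 0`, `L ≥ 1` there is `c₁′ > 0` with `c₁′ ≤ c₁`, `16·B₁′·c₁′ ≤ 1`, `C₀·2c₁′ ≤ ⅓`,
`4c₁′ ≤ c₂′` (Theorem 4's «there exists a constant c₁»: shrinking the threshold is free). [cite: Balaban1985RegularSpaces, Thm 4 p.88 («There exists a constant c₁»)] -/
theorem exists_window {L : ℕ} (hL : 1 ≤ L) {c₁ B₁' : ℝ} (hc₁ : 0 < c₁) (hB : 0 ≤ B₁') :
    ∃ c₁' : ℝ, 0 < c₁' ∧ c₁' ≤ c₁ ∧ 16 * (B₁' * c₁') ≤ 1 ∧ C0 d * (2 * c₁') ≤ 1 / 3 ∧ 4 * c₁' ≤ c2' d L := by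
  have hC := C0_pos d
  have hc2 := c2'_pos d L hL
  set c : ℝ := min c₁ (min (1 / (16 * (B₁' + 1))) (min (1 / (6 * C0 d)) (c2' d L / 4))) with hcdef
  have hc0 : 0 < c := lt_min hc₁ (lt_min (by positivity) (lt_min (by positivity) (by positivity)))
  have h1 : c ≤ 1 / (16 * (B₁' + 1)) := (min_le_right _ _).trans (min_le_left _ _)
  have h2 : c ≤ 1 / (6 * C0 d) := (min_le_right _ _).trans ((min_le_right _ _).trans (min_le_left _ _))
  have h3 : c ≤ c2' d L / 4 := (min_le_right _ _).trans ((min_le_right _ _).trans (min_le_right _ _))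
  refine ⟨c, hc0, min_le_left _ _, ?_, ?_, by linarith⟩
  · have h4 : B₁' * (1 / (16 * (B₁' + 1))) ≤ 1 / 16 := by
      rw [mul_one_div, div_le_div_iff₀ (by positivity) (by norm_num)]
      nlinarith
    nlinarith [mul_le_mul_of_nonneg_left h1 hB]
  · calc C0 d * (2 * c) ≤ C0 d * (2 * (1 / (6 * C0 d))) := by gcongr
      _ = 1 / 3 := by field_simp; ring

end Family

end

end Summit.QuantumFields.YangMills.BalabanUVNodes.N16.Thm4ZdOfLeaf
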